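import Summits.RiemannHypothesis.RiemannHypothesis.Theses.WeilComb
import Literature.NumberTheory.LFunctions.WeilExplicitProofs
import Literature.NumberTheory.LFunctions.WeilCriterionProofs
import Literature.NumberTheory.LFunctions.UniformWeilPositivityRH
import Literature.NumberTheory.LFunctions.WeilSmallSupportPositivity
import Literature.NumberTheory.LFunctions.WeilGroundEnergyProofs
import Literature.NumberTheory.LFunctions.WeilMellinBounds

/-!
# `WeilComb.CombShapePositivity` (item stmt-RiemannHypothesis-11229): load-bearing analysis, resistance, rungs

Negative-side knowledge for the crux `CombShapePositivity` of route `RiemannHypothesis/WeilComb`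
(refuter / cdisprove seat refuter-cdisprove-stmt-RiemannHypothesis-11229-0; helper file, supports 11229; no new
definitions — the fixed-shape comb `x ↦ Σ_{m ≤ M} a m · ε⁻¹ φ₀((x − log m)/ε)`, `φ₀ = expNegInvGlue (1 − u²)`, is
written through the local notation `(fun x : ℝ => ∑ m ∈ Finset.Icc 1 M, a m * (((ε : ℝ) : ℂ)⁻¹ * ((expNegInvGlue (1 - ((x - Real.log (m : ℝ)) / (ε : ℝ)) ^ 2) : ℝ) : ℂ)))`, which unfolds syntactically to the body of the route decl).

* `weilComb_shapeComb_isWeilTest` — every fixed-shape comb (any `ε`, incl. `0`) is a Weil test; hence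
  `weilComb_not_riemannHypothesis_of_not_combShapePositivity`: a refutation of the crux would refute RH
  (`WeilPositivity.of_riemannHypothesis explicit_formula_holds`, both in tree). No unconditional disproof exists
  short of `¬RH`; with the support item `CombShapeDetection` the crux is EQUIVALENT to RH
  (`weilComb_combShapePositivity_iff_riemannHypothesis_of_detection`).
* `weilComb_combShapePositivity_withoutPos_iff` — the only hypothesis `0 < ε` is idle (`ε = 0` is the zero comb by
  `0⁻¹ = 0`; `ε < 0` is the `−ε` instance with `a ↦ −a`): no `_false_without_` theorem can exist.
* `weilComb_shapeComb_nonneg_of_short` — UNCONDITIONAL RUNG: if the active nodes `N ≤ m ≤ N'` of `a` satisfy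
  `log N' − log N + 2|ε| ≤ log 2` the instance holds (Yoshida's theorem `weilPositivityOn_of_le_log_two_half` after a
  translation, `weilQuadratic_translate`); `weilComb_shapeComb_nonneg_of_weilPositivityOn` — cell `(ε, M)` follows
  from `WeilPositivityOn ((log M)/2 + |ε|)` alone; `weilComb_combShapePositivity_iff_eventually` — the crux equals
  its restriction to levels `M ≥ M₀` (extend coefficients by zero).
* `weilComb_not_combShapePositivity_strict` — the strict form is false (tight at `a = 0`).
-/

noncomputable section

open scoped BigOperators ComplexConjugate ContDiff
open Complex MeasureTheory Set Filter

namespace Summit.RiemannHypothesis.RiemannHypothesis.Theorems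

open Literature.NumberTheory.LFunctions
open Summit.RiemannHypothesis.RiemannHypothesis.Theses.WeilComb

/-- Sanity: the crux is literally the inline comb statement used below. [folklore] -/
theorem weilComb_combShapePositivity_iff_shapeComb :
    CombShapePositivity ↔ ∀ ε : ℝ, 0 < ε → ∀ (M : ℕ) (a : ℕ → ℂ),
      0 ≤ (weilQuadratic (fun x : ℝ => ∑ m ∈ Finset.Icc 1 M, a m * (((ε : ℝ) : ℂ)⁻¹ * ((expNegInvGlue (1 - ((x - Real.log (m : ℝ)) / (ε : ℝ)) ^ 2) : ℝ) : ℂ)))).re := Iff.rfl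

/-- Off `[log m − |ε|, log m + |ε|]` the `m`-th bump vanishes (`ε ≠ 0`). [folklore] -/
theorem weilComb_shapeBump_eq_zero {ε x c : ℝ} (hε : ε ≠ 0) (hx : |ε| ≤ |x - c|) :
    expNegInvGlue (1 - ((x - c) / ε) ^ 2) = 0 := by
  apply expNegInvGlue.zero_of_nonpos
  have h1 : 1 ≤ ((x - c) / ε) ^ 2 := by
    rw [div_pow, le_div_iff₀ (by positivity), one_mul, ← sq_abs, ← sq_abs (x - c)]
    exact pow_le_pow_left₀ (abs_nonneg _) hx 2
  linarith

/-- A comb whose coefficients live on `N ≤ m ≤ N'` (`1 ≤ N`) vanishes off `[log N − |ε|, log N' + |ε|]`.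
[folklore] -/
theorem weilComb_shapeComb_apply_eq_zero {ε : ℝ} {M N N' : ℕ} (hN : 1 ≤ N) {a : ℕ → ℂ}
    (ha : ∀ m, a m ≠ 0 → N ≤ m ∧ m ≤ N') {x : ℝ}
    (hx : x ∉ Icc (Real.log N - |ε|) (Real.log N' + |ε|)) : (fun x : ℝ => ∑ m ∈ Finset.Icc 1 M, a m * (((ε : ℝ) : ℂ)⁻¹ * ((expNegInvGlue (1 - ((x - Real.log (m : ℝ)) / (ε : ℝ)) ^ 2) : ℝ) : ℂ))) x = 0 := by
  refine Finset.sum_eq_zero fun m _ => ?_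
  by_cases ham : a m = 0
  · rw [ham, zero_mul]
  rcases eq_or_ne ε 0 with rfl | hε
  · simp
  obtain ⟨h1, h2⟩ := ha m ham
  have hNr : (0 : ℝ) < N := by exact_mod_cast hN
  have hlogN : Real.log N ≤ Real.log m := Real.log_le_log hNr (by exact_mod_cast h1)
  have hlogN' : Real.log m ≤ Real.log N' :=
    Real.log_le_log (by exact_mod_cast (lt_of_lt_of_le hN h1 : 0 < m)) (by exact_mod_cast h2)
  have hfar : |ε| ≤ |x - Real.log m| := by
    simp only [mem_Icc, not_and_or, not_le] at hx
    rcases hx with h | h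
    · calc |ε| ≤ Real.log m - x := by linarith [abs_nonneg ε]
        _ ≤ |x - Real.log m| := by rw [abs_sub_comm]; exact le_abs_self _
    · calc |ε| ≤ x - Real.log m := by linarith
        _ ≤ |x - Real.log m| := le_abs_self _
  rw [weilComb_shapeBump_eq_zero hε hfar]
  simp

/-- `tsupport` of a comb with coefficients on `N ≤ m ≤ N'`: `⊆ [log N − |ε|, log N' + |ε|]`. [folklore] -/
theorem weilComb_shapeComb_tsupport_subset_of_coeff {ε : ℝ} {M N N' : ℕ} (hN : 1 ≤ N) {a : ℕ → ℂ}
    (ha : ∀ m, a m ≠ 0 → N ≤ m ∧ m ≤ N') :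
    tsupport (fun x : ℝ => ∑ m ∈ Finset.Icc 1 M, a m * (((ε : ℝ) : ℂ)⁻¹ * ((expNegInvGlue (1 - ((x - Real.log (m : ℝ)) / (ε : ℝ)) ^ 2) : ℝ) : ℂ))) ⊆ Icc (Real.log N - |ε|) (Real.log N' + |ε|) :=
  closure_minimal (fun _ hx => by_contra fun h => hx (weilComb_shapeComb_apply_eq_zero hN ha h))
    isClosed_Icc

/-- `tsupport shapeComb ⊆ [−|ε|, log M + |ε|]`. [folklore] -/
theorem weilComb_shapeComb_tsupport_subset (ε : ℝ) (M : ℕ) (a : ℕ → ℂ) :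
    tsupport (fun x : ℝ => ∑ m ∈ Finset.Icc 1 M, a m * (((ε : ℝ) : ℂ)⁻¹ * ((expNegInvGlue (1 - ((x - Real.log (m : ℝ)) / (ε : ℝ)) ^ 2) : ℝ) : ℂ))) ⊆ Icc (-|ε|) (Real.log M + |ε|) := by
  have h := weilComb_shapeComb_tsupport_subset_of_coeff (ε := ε) (M := M) (N := 1) (N' := M) le_rfl
    (a := fun m => if m ∈ Finset.Icc 1 M then a m else 0) (fun m hm => by
      by_cases h' : m ∈ Finset.Icc 1 M
      · exact Finset.mem_Icc.mp h'
      · simp [h'] at hm)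
  have e : (fun x : ℝ => ∑ m ∈ Finset.Icc 1 M, ((fun m => if m ∈ Finset.Icc 1 M then a m else 0)) m * (((ε : ℝ) : ℂ)⁻¹ * ((expNegInvGlue (1 - ((x - Real.log (m : ℝ)) / (ε : ℝ)) ^ 2) : ℝ) : ℂ))) = (fun x : ℝ => ∑ m ∈ Finset.Icc 1 M, a m * (((ε : ℝ) : ℂ)⁻¹ * ((expNegInvGlue (1 - ((x - Real.log (m : ℝ)) / (ε : ℝ)) ^ 2) : ℝ) : ℂ))) := by
    funext x
    exact Finset.sum_congr rfl fun m hm => by simp [hm]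
  rw [e] at h
  simpa using h

/-- Every fixed-shape comb (any `ε`, `M`, `a`) is a Weil test: `weilQuadratic` of it is the genuine `W(g ⋆ g̃)`.
[folklore] -/
theorem weilComb_shapeComb_isWeilTest (ε : ℝ) (M : ℕ) (a : ℕ → ℂ) : IsWeilTest (fun x : ℝ => ∑ m ∈ Finset.Icc 1 M, a m * (((ε : ℝ) : ℂ)⁻¹ * ((expNegInvGlue (1 - ((x - Real.log (m : ℝ)) / (ε : ℝ)) ^ 2) : ℝ) : ℂ))) := by
  refine ⟨?_, HasCompactSupport.intro (K := Icc (-|ε|) (Real.log M + |ε|)) isCompact_Icc fun x hx => ?_⟩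
  · refine ContDiff.sum fun m _ => contDiff_const.mul (contDiff_const.mul ?_)
    have h1 : ContDiff ℝ ∞ fun x : ℝ => expNegInvGlue (1 - ((x - Real.log (m : ℝ)) / ε) ^ 2) :=
      expNegInvGlue.contDiff.comp
        (contDiff_const.sub (((contDiff_id.sub contDiff_const).div_const ε).pow 2))
    exact ofRealCLM.contDiff.comp h1
  · exact image_eq_zero_of_notMem_tsupport (f := (fun x : ℝ => ∑ m ∈ Finset.Icc 1 M, a m * (((ε : ℝ) : ℂ)⁻¹ * ((expNegInvGlue (1 - ((x - Real.log (m : ℝ)) / (ε : ℝ)) ^ 2) : ℝ) : ℂ))))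
      fun h => hx (weilComb_shapeComb_tsupport_subset ε M a h)

/-- **Resistance.** `RH` implies every instance of the crux (Weil's easy direction + explicit formula, in tree),
so a refutation of `CombShapePositivity` would be a refutation of the Riemann hypothesis. [folklore] -/
theorem weilComb_not_riemannHypothesis_of_not_combShapePositivity (h : ¬ CombShapePositivity) :
    ¬ RiemannHypothesis := fun hRH =>
  h fun ε _ M a => WeilPositivity.of_riemannHypothesis explicit_formula_holds hRH _
    (weilComb_shapeComb_isWeilTest ε M a)

/-- With the support item `CombShapeDetection` the crux is equivalent to RH (it is RH in comb coordinates).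
[folklore] -/
theorem weilComb_combShapePositivity_iff_riemannHypothesis_of_detection (hDet : CombShapeDetection) :
    CombShapePositivity ↔ RiemannHypothesis :=
  ⟨fun h => riemannHypothesis_iff_forall_weilPositivityOn.mpr (hDet h), fun hRH =>
    by_contra fun h => weilComb_not_riemannHypothesis_of_not_combShapePositivity h hRH⟩

/-- `ε ↦ −ε` is the coefficient flip `a ↦ −a` (the bump is even, `(−ε)⁻¹ = −ε⁻¹`). [folklore] -/
theorem weilComb_shapeComb_neg_eps (ε : ℝ) (M : ℕ) (a : ℕ → ℂ) :
    (fun x : ℝ => ∑ m ∈ Finset.Icc 1 M, a m * ((((-ε) : ℝ) : ℂ)⁻¹ * ((expNegInvGlue (1 - ((x - Real.log (m : ℝ)) / ((-ε) : ℝ)) ^ 2) : ℝ) : ℂ))) = (fun x : ℝ => ∑ m ∈ Finset.Icc 1 M, ((fun m => -a m)) m * (((ε : ℝ) : ℂ)⁻¹ * ((expNegInvGlue (1 - ((x - Real.log (m : ℝ)) / (ε : ℝ)) ^ 2) : ℝ) : ℂ))) := by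
  funext x
  refine Finset.sum_congr rfl fun m _ => ?_
  have h : ((x - Real.log (m : ℝ)) / -ε) ^ 2 = ((x - Real.log (m : ℝ)) / ε) ^ 2 := by
    rw [div_neg, neg_sq]
  rw [h]
  push_cast
  rw [inv_neg]
  ring

/-- **Load-bearing analysis.** The guard `0 < ε` is idle: the unguarded statement is equivalent to the crux
(`ε = 0` gives the zero comb by `(0 : ℂ)⁻¹ = 0`, `ε < 0` is the `−ε` instance with `a ↦ −a`). [folklore] -/
theorem weilComb_combShapePositivity_withoutPos_iff :
    (∀ (ε : ℝ) (M : ℕ) (a : ℕ → ℂ), 0 ≤ (weilQuadratic (fun x : ℝ => ∑ m ∈ Finset.Icc 1 M, a m * (((ε : ℝ) : ℂ)⁻¹ * ((expNegInvGlue (1 - ((x - Real.log (m : ℝ)) / (ε : ℝ)) ^ 2) : ℝ) : ℂ)))).re) ↔ CombShapePositivity := by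
  constructor
  · exact fun h ε _ M a => h ε M a
  · intro h ε M a
    rcases lt_trichotomy ε 0 with hε | rfl | hε
    · have key := h (-ε) (neg_pos.mpr hε) M (fun m => -a m)
      rw [← weilComb_shapeComb_neg_eps] at key
      simpa using key
    · have e : (fun x : ℝ => ∑ m ∈ Finset.Icc 1 M, a m * ((((0 : ℝ) : ℝ) : ℂ)⁻¹ * ((expNegInvGlue (1 - ((x - Real.log (m : ℝ)) / ((0 : ℝ) : ℝ)) ^ 2) : ℝ) : ℂ))) = 0 := by funext x; simp
      rw [e, weilQuadratic_zero]; simp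
    · exact h ε hε M a

/-- **Unconditional rung (short combs at any height).** If the active nodes `N ≤ m ≤ N'` of `a` satisfy
`log N' − log N + 2|ε| ≤ log 2`, the instance holds: translate by the midpoint into `[−(log 2)/2, (log 2)/2]`
(`weilQuadratic_translate`) and apply Yoshida's theorem (`weilPositivityOn_of_le_log_two_half`).
[cite: Yoshida1992, Thm. 1 (p. 310)] -/
theorem weilComb_shapeComb_nonneg_of_short {ε : ℝ} {M N N' : ℕ} (hN : 1 ≤ N) {a : ℕ → ℂ}
    (ha : ∀ m, a m ≠ 0 → N ≤ m ∧ m ≤ N') (hlen : Real.log N' - Real.log N + 2 * |ε| ≤ Real.log 2) :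
    0 ≤ (weilQuadratic (fun x : ℝ => ∑ m ∈ Finset.Icc 1 M, a m * (((ε : ℝ) : ℂ)⁻¹ * ((expNegInvGlue (1 - ((x - Real.log (m : ℝ)) / (ε : ℝ)) ^ 2) : ℝ) : ℂ)))).re := by
  set c : ℝ := (Real.log N + Real.log N') / 2 with hc
  set L : ℝ := (Real.log N' - Real.log N) / 2 + |ε| with hL
  have hLle : L ≤ Real.log 2 / 2 := by rw [hL]; linarith
  have hsupp : tsupport (fun t => (fun x : ℝ => ∑ m ∈ Finset.Icc 1 M, a m * (((ε : ℝ) : ℂ)⁻¹ * ((expNegInvGlue (1 - ((x - Real.log (m : ℝ)) / (ε : ℝ)) ^ 2) : ℝ) : ℂ))) (t + c)) ⊆ Icc (-L) L := by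
    refine (tsupport_translate_subset (weilComb_shapeComb_tsupport_subset_of_coeff (M := M) (ε := ε) hN ha)
      c).trans ?_
    apply Icc_subset_Icc <;> rw [hc, hL] <;> linarith
  have h := weilPositivityOn_of_le_log_two_half hLle _
    (isWeilTest_translate (weilComb_shapeComb_isWeilTest ε M a) c) hsupp
  have e := weilQuadratic_translate (fun x : ℝ => ∑ m ∈ Finset.Icc 1 M, a m * (((ε : ℝ) : ℂ)⁻¹ * ((expNegInvGlue (1 - ((x - Real.log (m : ℝ)) / (ε : ℝ)) ^ 2) : ℝ) : ℂ))) c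
  rwa [e] at h

/-- Each cell needs Weil positivity on ONE cone: `WeilPositivityOn ((log M)/2 + |ε|)` gives the `(ε, M)` instances
(translate by `(log M)/2`). [folklore] -/
theorem weilComb_shapeComb_nonneg_of_weilPositivityOn {ε : ℝ} {M : ℕ}
    (h : WeilPositivityOn (Real.log M / 2 + |ε|)) (a : ℕ → ℂ) :
    0 ≤ (weilQuadratic (fun x : ℝ => ∑ m ∈ Finset.Icc 1 M, a m * (((ε : ℝ) : ℂ)⁻¹ * ((expNegInvGlue (1 - ((x - Real.log (m : ℝ)) / (ε : ℝ)) ^ 2) : ℝ) : ℂ)))).re := by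
  set c : ℝ := Real.log M / 2 with hc
  have hsupp : tsupport (fun t => (fun x : ℝ => ∑ m ∈ Finset.Icc 1 M, a m * (((ε : ℝ) : ℂ)⁻¹ * ((expNegInvGlue (1 - ((x - Real.log (m : ℝ)) / (ε : ℝ)) ^ 2) : ℝ) : ℂ))) (t + c)) ⊆
      Icc (-(Real.log M / 2 + |ε|)) (Real.log M / 2 + |ε|) := by
    refine (tsupport_translate_subset (weilComb_shapeComb_tsupport_subset ε M a) c).trans ?_
    apply Icc_subset_Icc <;> rw [hc] <;> linarith
  have h' := h _ (isWeilTest_translate (weilComb_shapeComb_isWeilTest ε M a) c) hsupp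
  have e := weilQuadratic_translate (fun x : ℝ => ∑ m ∈ Finset.Icc 1 M, a m * (((ε : ℝ) : ℂ)⁻¹ * ((expNegInvGlue (1 - ((x - Real.log (m : ℝ)) / (ε : ℝ)) ^ 2) : ℝ) : ℂ))) c
  rwa [e] at h'

/-- Extending coefficients by zero: a level-`M` comb is a level-`M'` comb (`M ≤ M'`). [folklore] -/
theorem weilComb_shapeComb_extend {ε : ℝ} {M M' : ℕ} (hMM' : M ≤ M') (a : ℕ → ℂ) :
    (fun x : ℝ => ∑ m ∈ Finset.Icc 1 M', ((fun m => if m ≤ M then a m else 0)) m * (((ε : ℝ) : ℂ)⁻¹ * ((expNegInvGlue (1 - ((x - Real.log (m : ℝ)) / (ε : ℝ)) ^ 2) : ℝ) : ℂ))) = (fun x : ℝ => ∑ m ∈ Finset.Icc 1 M, a m * (((ε : ℝ) : ℂ)⁻¹ * ((expNegInvGlue (1 - ((x - Real.log (m : ℝ)) / (ε : ℝ)) ^ 2) : ℝ) : ℂ))) := by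
  funext x
  rw [← Finset.sum_subset (Finset.Icc_subset_Icc_right hMM')]
  · refine Finset.sum_congr rfl fun m hm => ?_
    rw [Finset.mem_Icc] at hm
    simp [hm.2]
  · intro m hm hm'
    rw [Finset.mem_Icc] at hm hm'
    have : ¬ m ≤ M := fun h => hm' ⟨hm.1, h⟩
    simp [this]

/-- **Level monotonicity.** The crux equals its restriction to levels `M ≥ M₀` (principal submatrices).
[folklore] -/
theorem weilComb_combShapePositivity_iff_eventually (M₀ : ℕ) :
    CombShapePositivity ↔ ∀ ε : ℝ, 0 < ε → ∀ M : ℕ, M₀ ≤ M → ∀ a : ℕ → ℂ,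
      0 ≤ (weilQuadratic (fun x : ℝ => ∑ m ∈ Finset.Icc 1 M, a m * (((ε : ℝ) : ℂ)⁻¹ * ((expNegInvGlue (1 - ((x - Real.log (m : ℝ)) / (ε : ℝ)) ^ 2) : ℝ) : ℂ)))).re := by
  refine ⟨fun h ε hε M _ => h ε hε M, fun h ε hε M a => ?_⟩
  have key := h ε hε (max M₀ M) (le_max_left _ _) (fun m => if m ≤ M then a m else 0)
  rwa [weilComb_shapeComb_extend (le_max_right M₀ M)] at key

/-- **Strict form is false** (tight at `a = 0`; also at `M = 0`). [folklore] -/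
theorem weilComb_not_combShapePositivity_strict :
    ¬ ∀ ε : ℝ, 0 < ε → ∀ (M : ℕ) (a : ℕ → ℂ), 0 < (weilQuadratic (fun x : ℝ => ∑ m ∈ Finset.Icc 1 M, a m * (((ε : ℝ) : ℂ)⁻¹ * ((expNegInvGlue (1 - ((x - Real.log (m : ℝ)) / (ε : ℝ)) ^ 2) : ℝ) : ℂ)))).re := by
  intro h
  have key := h 1 one_pos 1 0
  have e : (fun x : ℝ => ∑ m ∈ Finset.Icc 1 (1), ((0 : ℕ → ℂ)) m * ((((1 : ℝ) : ℝ) : ℂ)⁻¹ * ((expNegInvGlue (1 - ((x - Real.log (m : ℝ)) / ((1 : ℝ) : ℝ)) ^ 2) : ℝ) : ℂ))) = 0 := by funext x; simp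
  rw [e, weilQuadratic_zero] at key
  simp at key

end Summit.RiemannHypothesis.RiemannHypothesis.Theorems

end
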